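import Summits.Ventures.LatticeQCDFlow.Scaling.StepChainSpectralBound
import Literature.Probability.MarkovChains.SpectralMixingTimeBound
import Literature.Probability.MarkovChains.ReversibleSpectrumReal

/-!
HONEST FRAMING: exact (Metropolis-corrected) sampling algorithms for lattice gauge theory; figures
of merit are autocorrelation/cost numbers at stated couplings and volumes; no continuum-physics
claim.

# StepChainMixingTime — CYCLE → STEP, SPECTRAL ROUTE, CONCLUDED IN THE ABSTRACT: IF THE CYCLE CHAIN `C = UB` DECAYS AT RATE `θ` THEN THE STEP CHAIN `S = σA + (1−σ)B` HAS
# `λ⋆ ≤ 1 − (1−σ)(1−θ)`, `t_rel ≤ 1/((1−σ)(1−θ))` AND `t_mix(ε) ≤ ⌈(½log(1/π_min) + log(1/(2ε)))/((1−σ)(1−θ))⌉` STEPS (LPW THM 12.4 THROUGH THE TREE; lean-2 GEN-38, ours)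

Venture-side (OURS).  Cell `lqcd-flow` (pub-lqcd), unit `pub-lqcd-lean-2-g38`, 2026-08-30.  Chapter X (item 1 (i) (b)), file 4 = file X3 (`stepChain_eigenvalue_bounds`) plumbed into the
tree's spectral files: for `S` row-stochastic, reversible w.r.t. `π` and IRREDUCIBLE (hypothesis), `Literature/…/ReversibleSpectrumReal` identifies the non-trivial eigenvalues with
the `λ_j ≠ 1` of the symmetrised matrix and those with the eigenvalues carried by real eigenfunctions `⊥_π 1` (`orthEigenvalues_eq`), to which X3 applies; so `λ⋆(S) ≤ 1 − (1−σ)(1−θ)`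
(`stepChain_lambdaStar_le`), `t_rel(S) ≤ 1/((1−σ)(1−θ))`, and `Literature/…/SpectralMixingTimeBound.LevinPeres2017_thm_12_4_sharp` gives the mixing time in STEPS
(`stepChain_mixingTime_le`).  Files X5 (`LumpedStarStepChain`), X7 (`LumpedStarIrreducible`) and X6 (`LumpedStarStepMixingTime`) instantiate: `A` = one swap attempt, `B` = the redraw,
`π` = the star's stationary law, `C` = chapter W's refresh-cycle chain with `θ = 1−ρ` from W27.  Hypothesis-equations, no definitions.

## What is proved

* `stepChain_rowStochastic`, `stepChain_detailedBalance`, **`stepChain_lambdaStar_le`**, **`stepChain_mixingTime_le`**.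

Reading (no numerics implied): with W28's `ρ = σp̄/(2K+2)` this is `t_mix^{steps}(ε) = O((K/(σ(1−σ)p̄))·(log(1/π_min) + log(1/ε)))` for the lumped star (file X6) — the conjectured
step order up to `log(1/π_min)` in place of `log K`.  Literature grade (cell rule): LPW Thm 12.4 and Lemmas 12.1–12.3 through the tree's Literature files (proved there); nothing new
cited; no new bib keys.
-/

open Finset
open Literature.Probability.MarkovChains

namespace Summit.Ventures.LatticeQCDFlow.Scaling

section StepMixing
variable {X : Type*} [Fintype X] [DecidableEq X]
variable {π : X → ℝ} {A U B C S : X → X → ℝ} {σ : ℝ} {Cp : ℕ → X → X → ℝ} {πC : X → ℝ} {C₀ θ : ℝ}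

omit [DecidableEq X] in
/-- `S = σA + (1−σ)B` is row-stochastic. [ours] -/
theorem stepChain_rowStochastic (hA0 : ∀ x y, 0 ≤ A x y) (hA1 : ∀ x, ∑ y, A x y = 1) (hB0 : ∀ x y, 0 ≤ B x y) (hB1 : ∀ x, ∑ y, B x y = 1)
    (hσ0 : 0 ≤ σ) (hσ1 : σ < 1) (hS : ∀ x y, S x y = σ * A x y + (1 - σ) * B x y) : IsRowStochastic S := by
  refine ⟨fun x y => ?_, fun x => ?_⟩
  · rw [hS]; have := hA0 x y; have := hB0 x y; have : 0 ≤ 1 - σ := by linarith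
    positivity
  · rw [sum_congr rfl fun y _ => hS x y, sum_add_distrib, ← mul_sum, ← mul_sum, hA1, hB1]; ring

omit [Fintype X] [DecidableEq X] in
/-- `S` is reversible w.r.t. `π`. [ours] -/
theorem stepChain_detailedBalance (hrev : ∀ x y, π x * A x y = π y * A y x) (hBrev : ∀ x y, π x * B x y = π y * B y x)
    (hS : ∀ x y, S x y = σ * A x y + (1 - σ) * B x y) : DetailedBalance π S := by
  intro x y
  rw [hS, hS, mul_add, mul_add, mul_left_comm, hrev x y, mul_left_comm (π x), hBrev x y]; ring

/-- **`λ⋆(S) ≤ 1 − (1−σ)(1−θ)`** for the step chain of files X1–X3, `S` irreducible. [ours] -/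
theorem stepChain_lambdaStar_le [Nontrivial X] (hπ : ∀ x, 0 < π x) (hπ1 : ∑ x, π x = 1) (hA0 : ∀ x y, 0 ≤ A x y) (hA1 : ∀ x, ∑ y, A x y = 1)
    (hrev : ∀ x y, π x * A x y = π y * A y x) (hσ0 : 0 ≤ σ) (hσ1 : σ < 1)
    (hU : ∀ x y, U x y = (1 - σ) * (if x = y then 1 else 0) + σ * ∑ z, A x z * U z y)
    (hB0 : ∀ x y, 0 ≤ B x y) (hB1 : ∀ x, ∑ y, B x y = 1) (hBrev : ∀ x y, π x * B x y = π y * B y x) (hBB : ∀ x y, ∑ z, B x z * B z y = B x y)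
    (hC : ∀ x y, C x y = ∑ z, U x z * B z y) (hCp0 : ∀ x y, Cp 0 x y = if x = y then 1 else 0) (hCpS : ∀ n x y, Cp (n + 1) x y = ∑ z, Cp n x z * C z y)
    (hθ0 : 0 < θ) (hθ1 : θ ≤ 1) (hdec : ∀ n x, ∑ y, |Cp n x y - πC y| ≤ 2 * C₀ * θ ^ n)
    (hS : ∀ x y, S x y = σ * A x y + (1 - σ) * B x y) (hirr : IsIrreducible S) :
    lambdaStar S ≤ 1 - (1 - σ) * (1 - θ) := by
  have : Nonempty X := inferInstance
  have hSst := stepChain_rowStochastic hA0 hA1 hB0 hB1 hσ0 hσ1 hS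
  have hSDB := stepChain_detailedBalance hrev hBrev hS
  have hAh := symmMatrix_isHermitian hπ hSDB
  -- every `λ_j ≠ 1` is carried by a real eigenfunction `⊥_π 1`, where X3 applies
  have hbound : ∀ j, specVal hAh j ≠ 1 → |specVal hAh j| ≤ 1 - (1 - σ) * (1 - θ) := by
    intro j hj
    have hmem : specVal hAh j ∈ orthEigenvalues π S := by
      rw [orthEigenvalues_eq hπ hπ1 hSst hSDB hirr hAh]; exact ⟨j, hj, rfl⟩
    obtain ⟨f, hfne, hf0, hf⟩ := hmem
    have heig : ∀ x, ∑ y, S x y * f y = specVal hAh j * f x := by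
      intro x
      have h := congr_fun hf x
      simp only [Matrix.mulVec, dotProduct, Pi.smul_apply, smul_eq_mul] at h
      exact h
    have hfne' : ∃ x, f x ≠ 0 := by
      by_contra h
      push Not at h
      exact hfne (funext h)
    obtain ⟨hlo, hhi⟩ := stepChain_eigenvalue_bounds hπ hA0 hA1 hrev hσ0 hσ1 hU hBrev hBB hC hCp0 hCpS hθ0 hθ1 hdec hS hf0 hfne' heig
    rw [abs_le]
    constructor
    · have : σ ≤ 1 - (1 - σ) * (1 - θ) := by nlinarith
      linarith
    · exact hhi
  by_cases hne : (univ.filter (fun j => specVal hAh j ≠ 1)).Nonempty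
  · rw [lambdaStar_eq_sup hπ hAh hne]
    exact sup'_le hne _ fun j hj => hbound j (mem_filter.mp hj).2
  · -- no non-trivial eigenvalue: `λ⋆ = sSup ∅ = 0`
    have hempty : nontrivialEigenvalues S = ∅ := by
      rw [nontrivialEigenvalues_eq hπ hAh]
      ext μ
      simp only [Set.mem_image, Set.mem_setOf_eq, Set.mem_empty_iff_false, iff_false, not_exists, not_and]
      intro j hj _
      exact hne ⟨j, mem_filter.mpr ⟨mem_univ _, hj⟩⟩
    have h0 : lambdaStar S = 0 := by unfold lambdaStar; rw [hempty, Set.image_empty, Real.sSup_empty]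
    rw [h0]
    nlinarith

/-- **THE MIXING TIME OF THE STEP CHAIN IN STEPS:** `t_mix(S; ε) ≤ ⌈(1/((1−σ)(1−θ)))·(½log(1/π_min) + log(1/(2ε)))⌉` for `0 < ε ≤ ½`, `θ < 1`, `0 < π_min ≤ π`. [ours] -/
theorem stepChain_mixingTime_le [Nontrivial X] (hπ : ∀ x, 0 < π x) (hπ1 : ∑ x, π x = 1) (hA0 : ∀ x y, 0 ≤ A x y) (hA1 : ∀ x, ∑ y, A x y = 1)
    (hrev : ∀ x y, π x * A x y = π y * A y x) (hσ0 : 0 ≤ σ) (hσ1 : σ < 1)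
    (hU : ∀ x y, U x y = (1 - σ) * (if x = y then 1 else 0) + σ * ∑ z, A x z * U z y)
    (hB0 : ∀ x y, 0 ≤ B x y) (hB1 : ∀ x, ∑ y, B x y = 1) (hBrev : ∀ x y, π x * B x y = π y * B y x) (hBB : ∀ x y, ∑ z, B x z * B z y = B x y)
    (hC : ∀ x y, C x y = ∑ z, U x z * B z y) (hCp0 : ∀ x y, Cp 0 x y = if x = y then 1 else 0) (hCpS : ∀ n x y, Cp (n + 1) x y = ∑ z, Cp n x z * C z y)
    (hθ0 : 0 < θ) (hθ1 : θ < 1) (hdec : ∀ n x, ∑ y, |Cp n x y - πC y| ≤ 2 * C₀ * θ ^ n)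
    (hS : ∀ x y, S x y = σ * A x y + (1 - σ) * B x y) (hirr : IsIrreducible S)
    {πmin : ℝ} (hmin0 : 0 < πmin) (hmin : ∀ x, πmin ≤ π x) {ε : ℝ} (hε : 0 < ε) (hε1 : ε ≤ 1 / 2) :
    mixingTime S π ε ≤ ⌈1 / ((1 - σ) * (1 - θ)) * (Real.log (1 / πmin) / 2 + Real.log (1 / (2 * ε)))⌉₊ := by
  have hSst := stepChain_rowStochastic hA0 hA1 hB0 hB1 hσ0 hσ1 hS
  have hSDB := stepChain_detailedBalance hrev hBrev hS
  have hls := stepChain_lambdaStar_le hπ hπ1 hA0 hA1 hrev hσ0 hσ1 hU hB0 hB1 hBrev hBB hC hCp0 hCpS hθ0 hθ1.le hdec hS hirr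
  have hγ : 0 < (1 - σ) * (1 - θ) := mul_pos (by linarith) (by linarith)
  have hgap : lambdaStar S < 1 := by linarith
  have h12 := LevinPeres2017_thm_12_4_sharp hπ hπ1 hSst hSDB hirr hgap hmin0 hmin hε
  refine h12.trans (Nat.ceil_mono ?_)
  -- `t_rel ≤ 1/((1−σ)(1−θ))` and the bracket is non-negative
  have hL : 0 ≤ Real.log (1 / πmin) / 2 + Real.log (1 / (2 * ε)) := by
    have h1 : 0 ≤ Real.log (1 / πmin) := by
      apply Real.log_nonneg
      have : πmin ≤ 1 := by
        obtain ⟨x⟩ := (inferInstance : Nonempty X)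
        have := hmin x
        have hπx1 : π x ≤ 1 := by
          calc π x = ∑ y ∈ {x}, π y := by simp
            _ ≤ ∑ y, π y := sum_le_sum_of_subset_of_nonneg (subset_univ _) fun y _ _ => (hπ y).le
            _ = 1 := hπ1
        linarith
      rw [le_div_iff₀ hmin0]; linarith
    have h2 : 0 ≤ Real.log (1 / (2 * ε)) := by
      apply Real.log_nonneg; rw [le_div_iff₀ (by linarith)]; linarith
    linarith
  have htrel : relaxationTime S ≤ 1 / ((1 - σ) * (1 - θ)) := by
    unfold relaxationTime absSpectralGap
    exact one_div_le_one_div_of_le hγ (by linarith)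
  exact mul_le_mul_of_nonneg_right htrel hL

end StepMixing

end Summit.Ventures.LatticeQCDFlow.Scaling
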